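import Summits.CriticalPhenomena.CardyFormulaZ2.Theorems.CardyIKTransportIKLinearTransportStubCutMarkovKernelBits

/-!
# Stub `stub_CutMarkovKernel` (K) — part E: THREE INDEPENDENT SAMPLES and what each side of the cut reads

Support file (`--supports stmt-CriticalPhenomena-5076`, registered sub-goal `cmk_nuMix_eq_map_glue3`).

In the cut-adapted gauge of `…StubCutMarkovKernelBits.lean` the coded bits split, for a cut row `c ≤ 0`, into
the UPPER NOISE `cmkGb` (biased plaquettes of the isotropic column of the rows `≥ c`, its coins of the rows
`> c`), the SHARED DATA `cmkGe` (column bits of the cell columns `i+1, i+2`, row bits and honeycomb fair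
plaquettes of the rows `≥ c`) and the LOWER DATA (everything else). Gluing three independent samples along this
partition gives a sample (`cmk_PJ3_map_glue3`, two applications of the gluing lemma `SDE.infinitePi_glue`), so
`νmix T` is the image of `PJ ⊗ (PJ ⊗ PJ)` under `cmkΞ ∘ cmkGlue3` (`cmk_nuMix_eq_map_glue3`, registered); and
the strip above the cut reads only (shared, upper) bits while the strip below the cut, the boundary columns and
the whole environment `eraseMid` read no upper bit (`cmk_agree_up`, `cmk_agree_lo`).
-/

noncomputable section

namespace Summit.CriticalPhenomena.CardyFormulaZ2.Theorems.IKLinearTransport.PinnedDiagramExchange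

open scoped Classical MeasureTheory ENNReal ProbabilityTheory symmDiff
open Set MeasureTheory
open Literature.Probability.Percolation Literature.Probability.LatticeModels

/-! ## The three groups of coordinates and the triple gluing -/

/-- UPPER NOISE: isotropic biased plaquettes of the rows `≥ c` and isotropic coins of the rows `> c`. [folklore] -/
def cmkGb (i : ℤ) (τ : Bool) (c : ℤ) : Set SDE.JIdx :=
  {j | (∃ y, c ≤ y ∧ j = jBP ![SDE.isoC i τ, y]) ∨ (∃ y, c + 1 ≤ y ∧ j = jCO ![SDE.isoC i τ, y])}

/-- SHARED DATA: column bits of columns `i+1, i+2`, row bits and honeycomb fair plaquettes of the rows `≥ c`. [folklore] -/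
def cmkGe (i : ℤ) (τ : Bool) (c : ℤ) : Set SDE.JIdx :=
  {j | j = jCB (i + 1) ∨ j = jCB (i + 2) ∨ (∃ y, c ≤ y ∧ j = jRB y) ∨ (∃ y, c ≤ y ∧ j = jFP ![SDE.hcC i τ, y])}

/-- THE TRIPLE GLUING `(a, θ, b) ↦ g`: upper noise from `b`, shared data from `θ`, the rest from `a`. [folklore] -/
def cmkGlue3 (i : ℤ) (τ : Bool) (c : ℤ) (p : SDE.KJ × SDE.KJ × SDE.KJ) : SDE.KJ :=
  fun j => if j ∈ cmkGb i τ c then p.2.2 j else if j ∈ cmkGe i τ c then p.2.1 j else p.1 j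

/-- Projection of the shared sample onto the shared coordinates (all other bits cleared). [folklore] -/
def cmkPr (i : ℤ) (τ : Bool) (c : ℤ) (θ : SDE.KJ) : SDE.KJ := fun j => decide (j ∈ cmkGe i τ c) && θ j

/-- The triple product law. [folklore] -/
def cmkP3 : Measure (SDE.KJ × SDE.KJ × SDE.KJ) := SDE.PJ.prod (SDE.PJ.prod SDE.PJ)

/-- `cmkP3` is a probability measure. [folklore] -/
instance cmk_isProbabilityMeasure_P3 : IsProbabilityMeasure cmkP3 := by unfold cmkP3; infer_instance

/-- `cmkGlue3` through two binary gluings. [folklore] -/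
theorem cmk_glue3_eq (i : ℤ) (τ : Bool) (c : ℤ) (p : SDE.KJ × SDE.KJ × SDE.KJ) :
    cmkGlue3 i τ c p = SDE.glue (cmkGb i τ c) (SDE.glue (cmkGe i τ c) p.1 p.2.1) p.2.2 := by
  funext j; simp only [cmkGlue3, SDE.glue]

/-- Binary gluing is measurable. [folklore] -/
theorem cmk_measurable_glue (A : Set SDE.JIdx) : Measurable fun p : SDE.KJ × SDE.KJ => SDE.glue A p.1 p.2 := by
  refine measurable_pi_lambda _ fun j => ?_
  by_cases hj : j ∈ A
  · simp only [SDE.glue, hj, if_true]; fun_prop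
  · simp only [SDE.glue, hj, if_false]; fun_prop

/-- `cmkGlue3` is measurable. [folklore] -/
theorem cmk_measurable_glue3 (i : ℤ) (τ : Bool) (c : ℤ) : Measurable (cmkGlue3 i τ c) := by
  refine measurable_pi_lambda _ fun j => ?_
  by_cases hj : j ∈ cmkGb i τ c
  · simp only [cmkGlue3, hj, if_true]; fun_prop
  · by_cases hj' : j ∈ cmkGe i τ c
    · simp only [cmkGlue3, hj, hj', if_true, if_false]; fun_prop
    · simp only [cmkGlue3, hj, hj', if_false]; fun_prop

/-- `cmkPr` is measurable. [folklore] -/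
theorem cmk_measurable_pr (i : ℤ) (τ : Bool) (c : ℤ) : Measurable (cmkPr i τ c) :=
  measurable_pi_lambda _ fun j => by unfold cmkPr; fun_prop

/-- GLUING THREE INDEPENDENT SAMPLES GIVES A SAMPLE. [folklore] -/
theorem cmk_P3_map_glue3 (i : ℤ) (τ : Bool) (c : ℤ) : cmkP3.map (cmkGlue3 i τ c) = SDE.PJ := by
  have hglue : ∀ A : Set SDE.JIdx, (SDE.PJ.prod SDE.PJ).map (fun p => SDE.glue A p.1 p.2) = SDE.PJ := fun A => by
    unfold SDE.PJ; exact SDE.infinitePi_glue _ _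
  have hfac : cmkGlue3 i τ c = (fun q : SDE.KJ × SDE.KJ => SDE.glue (cmkGb i τ c) q.1 q.2) ∘
      (Prod.map (fun q : SDE.KJ × SDE.KJ => SDE.glue (cmkGe i τ c) q.1 q.2) id ∘
        (MeasurableEquiv.prodAssoc : (SDE.KJ × SDE.KJ) × SDE.KJ ≃ᵐ _).symm) := by
    funext p; rw [cmk_glue3_eq]; rfl
  have hA : cmkP3.map (MeasurableEquiv.prodAssoc : (SDE.KJ × SDE.KJ) × SDE.KJ ≃ᵐ _).symm = (SDE.PJ.prod SDE.PJ).prod SDE.PJ :=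
    ((measurePreserving_prodAssoc SDE.PJ SDE.PJ SDE.PJ).symm _).map_eq
  have hB : ((SDE.PJ.prod SDE.PJ).prod SDE.PJ).map (Prod.map (fun q : SDE.KJ × SDE.KJ => SDE.glue (cmkGe i τ c) q.1 q.2) id) =
      SDE.PJ.prod SDE.PJ := by
    rw [← Measure.map_prod_map _ _ (cmk_measurable_glue _) measurable_id, hglue, Measure.map_id]
  have hem : Measurable ((MeasurableEquiv.prodAssoc : (SDE.KJ × SDE.KJ) × SDE.KJ ≃ᵐ _).symm) := MeasurableEquiv.measurable _
  have hpm : Measurable (Prod.map (fun q : SDE.KJ × SDE.KJ => SDE.glue (cmkGe i τ c) q.1 q.2) (id : SDE.KJ → SDE.KJ)) :=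
    (cmk_measurable_glue _).prodMap measurable_id
  rw [hfac, ← Measure.map_map (cmk_measurable_glue _) (hpm.comp hem), ← Measure.map_map hpm hem, hA, hB, hglue]

/-- The gluing reads the shared sample only through its shared coordinates. [folklore] -/
theorem cmk_glue3_pr (i : ℤ) (τ : Bool) (c : ℤ) (a θ b : SDE.KJ) :
    cmkGlue3 i τ c (a, cmkPr i τ c θ, b) = cmkGlue3 i τ c (a, θ, b) := by
  funext j
  by_cases hj : j ∈ cmkGb i τ c
  · simp [cmkGlue3, hj]
  · by_cases hj' : j ∈ cmkGe i τ c <;> simp [cmkGlue3, cmkPr, hj, hj']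

/-- `cmkPr` is idempotent and reads only the shared coordinates. [folklore] -/
theorem cmk_pr_pr (i : ℤ) (τ : Bool) (c : ℤ) (θ : SDE.KJ) : cmkPr i τ c (cmkPr i τ c θ) = cmkPr i τ c θ := by
  funext j; by_cases hj : j ∈ cmkGe i τ c <;> simp [cmkPr, hj]

/-- THE LAW OF THE OBSERVABLES FROM THREE INDEPENDENT SAMPLES (registered sub-goal `cmk_nuMix_eq_map_glue3`). [folklore] -/
theorem cmk_nuMix_eq_map_glue3 : ∀ (i : ℤ) (T : Set ℤ) (c : ℤ),
    νmix T = cmkP3.map (cmkΞ i T c ∘ cmkGlue3 i (decide (i ∈ T)) c) := by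
  intro i T c
  rw [cmk_nuMix_eq_map_Xi i T c, ← Measure.map_map (cmk_measurable_Ξ i T c) (cmk_measurable_glue3 i _ c), cmk_P3_map_glue3]

/-! ## What each side of the cut reads -/

section Reads

variable (i : ℤ) (τ : Bool) (c : ℤ)

/-- Membership of the basic coordinates in the upper noise. [folklore] -/
theorem cmk_mem_Gb :
    (∀ x, jCB x ∉ cmkGb i τ c) ∧ (∀ y, jRB y ∉ cmkGb i τ c) ∧ (∀ f, jFP f ∉ cmkGb i τ c) ∧
    (∀ y, jBP ![SDE.isoC i τ, y] ∈ cmkGb i τ c ↔ c ≤ y) ∧ (∀ y, jCO ![SDE.isoC i τ, y] ∈ cmkGb i τ c ↔ c + 1 ≤ y) ∧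
    (∀ f : Site 2, f 0 ≠ i → f 0 ≠ i + 1 → jBP f ∉ cmkGb i τ c ∧ jCO f ∉ cmkGb i τ c) := by
  have hiso : SDE.isoC i τ = i ∨ SDE.isoC i τ = i + 1 := by unfold SDE.isoC; cases τ <;> simp
  refine ⟨fun x => ?_, fun y => ?_, fun f => ?_, fun y => ?_, fun y => ?_, fun f h1 h2 => ⟨?_, ?_⟩⟩ <;>
    simp only [cmkGb, mem_setOf_eq, jCB, jRB, jBP, jFP, jCO, Sum.inl.injEq, Sum.inr.injEq, reduceCtorEq,
      and_false, exists_false, or_false, false_or, or_self, not_false_eq_true, SquareTiling.vec2_eq_iff, true_and]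
  · exact ⟨fun ⟨y', h, e⟩ => e ▸ h, fun h => ⟨y, h, rfl⟩⟩
  · exact ⟨fun ⟨y', h, e⟩ => e ▸ h, fun h => ⟨y, h, rfl⟩⟩
  · rintro ⟨y, -, rfl⟩; simp at h1 h2; omega
  · rintro ⟨y, -, rfl⟩; simp at h1 h2; omega

/-- Membership of the basic coordinates in the shared data. [folklore] -/
theorem cmk_mem_Ge :
    (jCB (i + 1) ∈ cmkGe i τ c) ∧ (jCB (i + 2) ∈ cmkGe i τ c) ∧ (∀ y, jRB y ∈ cmkGe i τ c ↔ c ≤ y) ∧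
    (∀ y, jFP ![SDE.hcC i τ, y] ∈ cmkGe i τ c ↔ c ≤ y) ∧ (∀ f : Site 2, jFP f ∈ cmkGe i τ c → f 0 = SDE.hcC i τ ∧ c ≤ f 1) := by
  refine ⟨Or.inl rfl, Or.inr (Or.inl rfl), fun y => ?_, fun y => ?_, fun f hf => ?_⟩
  · simp only [cmkGe, mem_setOf_eq, jCB, jRB, jFP, Sum.inl.injEq, Sum.inr.injEq, reduceCtorEq,
      and_false, exists_false, or_false, false_or]
    exact ⟨fun ⟨y', h, e⟩ => e ▸ h, fun h => ⟨y, h, rfl⟩⟩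
  · simp only [cmkGe, mem_setOf_eq, jCB, jRB, jFP, Sum.inl.injEq, Sum.inr.injEq, reduceCtorEq,
      and_false, exists_false, false_or, SquareTiling.vec2_eq_iff, true_and]
    exact ⟨fun ⟨y', h, e⟩ => e ▸ h, fun h => ⟨y, h, rfl⟩⟩
  · rcases hf with h | h | ⟨y, -, h⟩ | ⟨y, hy, h⟩
    · exact absurd h (by simp [jFP, jCB])
    · exact absurd h (by simp [jFP, jCB])
    · exact absurd h (by simp [jFP, jRB])
    · have e : f = ![SDE.hcC i τ, y] := by simpa [jFP] using h
      subst e; simpa using hy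

variable {i τ c}

/-- Congruence of the right boundary colour. [folklore] -/
theorem cmkZe_congr {g g' : SDE.KJ} {y : ℤ} (h2 : g (jCB (i + 2)) = g' (jCB (i + 2))) (hr : g (jRB y) = g' (jRB y))
    (hF : ∀ s ∈ Finset.Ico (min 0 y) (max 0 y), cmkF i τ g s = cmkF i τ g' s) : cmkZe i τ g y = cmkZe i τ g' y := by
  simp only [cmkZe, h2, hr, cmk_bp_congr' hF]

/-- Congruence of the middle colour. [folklore] -/
theorem cmkMi_congr {g g' : SDE.KJ} {y : ℤ} (h1 : g (jCB (i + 1)) = g' (jCB (i + 1))) (hr : g (jRB y) = g' (jRB y))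
    (hF : ∀ s ∈ Finset.Ico (min 0 y) (max 0 y), cmkF i τ g s = cmkF i τ g' s)
    (hB : ∀ s ∈ Finset.Ico (min c y) (max c y), cmkB i τ g s = cmkB i τ g' s) : cmkMi i τ c g y = cmkMi i τ c g' y := by
  simp only [cmkMi, h1, hr, cmk_bp_congr' hF, cmk_bp_congr' hB]

variable (i : ℤ) {T : Set ℤ} (c : ℤ) (hT : i ∈ T ↔ i + 1 ∉ T) {τ : Bool} (hτ : decide (i ∈ T) = τ)
include hT hτ

/-- THE UPPER STRIP READS ONLY SHARED AND UPPER BITS: strip cells of the rows `≥ c` and middle faces of the rows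
`> c`. [folklore] -/
theorem cmk_agree_up (hc : c ≤ 0) {g g' : SDE.KJ} (h : ∀ j, (j ∈ cmkGe i τ c ∨ j ∈ cmkGb i τ c) → g j = g' j) :
    (∀ v : Site 2, i ≤ v 0 → v 0 ≤ i + 2 → c ≤ v 1 → (v ∈ (cmkΞ i T c g).1 ↔ v ∈ (cmkΞ i T c g').1)) ∧
    (∀ f : Site 2, (f 0 = i ∨ f 0 = i + 1) → c + 1 ≤ f 1 → (f ∈ (cmkΞ i T c g).2 ↔ f ∈ (cmkΞ i T c g').2)) := by
  obtain ⟨hE1, hE2, hEr, hEF, -⟩ := cmk_mem_Ge i τ c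
  obtain ⟨-, -, -, hBb, hBc, -⟩ := cmk_mem_Gb i τ c
  have hr : ∀ y, c ≤ y → g (jRB y) = g' (jRB y) := fun y hy => h _ (Or.inl ((hEr y).2 hy))
  have hF : ∀ y, c ≤ y → ∀ s ∈ Finset.Ico (min 0 y) (max 0 y), cmkF i τ g s = cmkF i τ g' s := fun y hy s hs =>
    h _ (Or.inl ((hEF s).2 (by rw [Finset.mem_Ico] at hs; omega)))
  have hB : ∀ y, c ≤ y → ∀ s ∈ Finset.Ico (min c y) (max c y), cmkB i τ g s = cmkB i τ g' s := fun y hy s hs =>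
    h _ (Or.inr ((hBb s).2 (by rw [Finset.mem_Ico] at hs; omega)))
  refine ⟨fun v hv0 hv0' hv1 => ?_, fun f hf0 hf1 => ?_⟩
  · rcases (show v 0 = i ∨ v 0 = i + 1 ∨ v 0 = i + 2 by omega) with e | e | e
    · rw [cmk_mem_Xi_col0 i c hτ g v e, cmk_mem_Xi_col0 i c hτ g' v e, cmkXi, cmkXi, hr _ hv1]
    · rw [cmk_mem_Xi_col1 i c hτ g v e, cmk_mem_Xi_col1 i c hτ g' v e, cmkMi_congr (h _ (Or.inl hE1)) (hr _ hv1) (hF _ hv1) (hB _ hv1)]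
    · rw [cmk_mem_Xi_col2 i c hT hτ g v e, cmk_mem_Xi_col2 i c hT hτ g' v e, cmkZe_congr (h _ (Or.inl hE2)) (hr _ hv1) (hF _ hv1)]
  · have ht : cmkTi i τ g (f 1) = cmkTi i τ g' (f 1) := h _ (Or.inr ((hBc (f 1)).2 hf1))
    rcases hf0 with e | e
    · rw [cmk_mem_Xi2_col0 i c hτ g f e, cmk_mem_Xi2_col0 i c hτ g' f e, ht]
    · rw [cmk_mem_Xi2_col1 i c hT hτ g f e, cmk_mem_Xi2_col1 i c hT hτ g' f e, ht]

omit hT hτ in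
/-- Congruence of the off-data map in its bit argument. [folklore] -/
theorem cmk_EE_congr {b₁ b₁' : SDE.KJ} (hx : ∀ x : ℤ, x ≠ i + 1 → b₁ (Sum.inl x) = b₁' (Sum.inl x))
    (hf : ∀ f : Site 2, f 0 ≠ i → f 0 ≠ i + 1 → b₁ (jBP f) = b₁' (jBP f) ∧ b₁ (jFP f) = b₁' (jFP f) ∧ b₁ (jCO f) = b₁' (jCO f))
    (ξζ : (ℤ → Bool) × (ℤ → Bool)) : SDE.EE i T b₁ ξζ = SDE.EE i T b₁' ξζ := by
  have hpar : ∀ (a d : ℤ) (v : Site 2), (d ≤ i ∨ i + 2 ≤ a) →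
      (Finset.filter (fun f : ℤ × ℤ => SDE.parJ T b₁ ![f.1, f.2] = true) (Finset.Ico a d ×ˢ Finset.Ico (min 0 (v 1)) (max 0 (v 1)))) =
      (Finset.filter (fun f : ℤ × ℤ => SDE.parJ T b₁' ![f.1, f.2] = true) (Finset.Ico a d ×ˢ Finset.Ico (min 0 (v 1)) (max 0 (v 1)))) := by
    intro a d v had
    refine Finset.filter_congr fun f hf' => ?_
    rw [Finset.mem_product, Finset.mem_Ico] at hf'
    obtain ⟨e1, e2, -⟩ := hf ![f.1, f.2] (by simp; omega) (by simp; omega)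
    simp only [SDE.parJ, jBP, jFP] at e1 e2 ⊢
    rw [e1, e2]
  have hi : b₁ (Sum.inl i) = b₁' (Sum.inl i) := hx i (by omega)
  have hi2 : b₁ (Sum.inl (i + 2)) = b₁' (Sum.inl (i + 2)) := hx (i + 2) (by omega)
  refine Prod.ext (Set.ext fun v => ?_) (Set.ext fun f => ?_)
  · simp only [SDE.EE, mem_setOf_eq, hi, hi2, hpar (v 0) i v (Or.inl le_rfl), hpar (i + 2) (v 0) v (Or.inr le_rfl)]
    by_cases hv : v 0 = i + 1
    · simp [hv]
    · rw [hx (v 0) hv]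
  · simp only [SDE.EE, mem_setOf_eq]
    constructor
    · rintro ⟨h1, h2⟩
      have e := (hf f h1.1 h1.2).2.2; simp only [jCO] at e
      exact ⟨h1, by rw [← e]; exact h2⟩
    · rintro ⟨h1, h2⟩
      have e := (hf f h1.1 h1.2).2.2; simp only [jCO] at e
      exact ⟨h1, by rw [e]; exact h2⟩

/-- THE LOWER STRIP, THE BOUNDARY AND THE ENVIRONMENT READ NO UPPER BIT. [folklore] -/
theorem cmk_agree_lo {g g' : SDE.KJ} (h : ∀ j, j ∉ cmkGb i τ c → g j = g' j) :
    (∀ v : Site 2, (v 0 = i ∨ v 0 = i + 2) → (v ∈ (cmkΞ i T c g).1 ↔ v ∈ (cmkΞ i T c g').1)) ∧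
    (∀ v : Site 2, v 0 = i + 1 → v 1 ≤ c → (v ∈ (cmkΞ i T c g).1 ↔ v ∈ (cmkΞ i T c g').1)) ∧
    (∀ f : Site 2, (f 0 = i ∨ f 0 = i + 1) → f 1 ≤ c → (f ∈ (cmkΞ i T c g).2 ↔ f ∈ (cmkΞ i T c g').2)) ∧
    eraseMid i (cmkΞ i T c g) = eraseMid i (cmkΞ i T c g') := by
  obtain ⟨hGx, hGr, hGF, hBb, hBc, hGoff⟩ := cmk_mem_Gb i τ c
  have hx : ∀ x, g (jCB x) = g' (jCB x) := fun x => h _ (hGx x)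
  have hr : ∀ y, g (jRB y) = g' (jRB y) := fun y => h _ (hGr y)
  have hF : ∀ s, cmkF i τ g s = cmkF i τ g' s := fun s => h _ (hGF _)
  have hB : ∀ s, s < c → cmkB i τ g s = cmkB i τ g' s := fun s hs => h _ (fun hm => by have := (hBb s).1 hm; omega)
  have hXi : cmkXi g = cmkXi g' := funext fun y => hr y
  have hZe : cmkZe i τ g = cmkZe i τ g' := funext fun y => cmkZe_congr (hx _) (hr _) (fun s _ => hF s)
  refine ⟨fun v hv0 => ?_, fun v hv0 hv1 => ?_, fun f hf0 hf1 => ?_, ?_⟩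
  · rcases hv0 with e | e
    · rw [cmk_mem_Xi_col0 i c hτ g v e, cmk_mem_Xi_col0 i c hτ g' v e, hXi]
    · rw [cmk_mem_Xi_col2 i c hT hτ g v e, cmk_mem_Xi_col2 i c hT hτ g' v e, hZe]
  · rw [cmk_mem_Xi_col1 i c hτ g v hv0, cmk_mem_Xi_col1 i c hτ g' v hv0,
      cmkMi_congr (hx _) (hr _) (fun s _ => hF s) (fun s hs => hB s (by rw [Finset.mem_Ico] at hs; omega))]
  · have ht : cmkTi i τ g (f 1) = cmkTi i τ g' (f 1) := h _ (fun hm => by have := (hBc (f 1)).1 hm; omega)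
    rcases hf0 with e | e
    · rw [cmk_mem_Xi2_col0 i c hτ g f e, cmk_mem_Xi2_col0 i c hτ g' f e, ht]
    · rw [cmk_mem_Xi2_col1 i c hT hτ g f e, cmk_mem_Xi2_col1 i c hT hτ g' f e, ht]
  · rw [cmk_eraseMid_Xi i c hT hτ g, cmk_eraseMid_Xi i c hT hτ g', hXi, hZe]
    refine cmk_EE_congr i (fun x hxi => ?_) (fun f h1 h2 => ?_) _
    · show (g (Sum.inl x) ^^ cmkCorr i τ c g (Sum.inl x)) = (g' (Sum.inl x) ^^ cmkCorr i τ c g' (Sum.inl x))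
      have d : decide (x = i + 1) = false := decide_eq_false hxi
      simp only [cmkCorr, d, Bool.false_and, Bool.xor_false]
      rw [show g (Sum.inl x) = g' (Sum.inl x) from hx x, show g (jCB i) = g' (jCB i) from hx i]
    · obtain ⟨hb, hco⟩ := hGoff f h1 h2
      have hhc : f 0 ≠ SDE.hcC i τ := by unfold SDE.hcC; cases τ <;> simp <;> omega
      have d : decide (f 0 = SDE.hcC i τ) = false := decide_eq_false hhc
      refine ⟨?_, ?_, ?_⟩
      · show (g (jBP f) ^^ false) = (g' (jBP f) ^^ false); rw [h _ hb]
      · show (g (jFP f) ^^ (decide (f 0 = SDE.hcC i τ) && g (jBP ![SDE.isoC i τ, f 1]))) =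
          (g' (jFP f) ^^ (decide (f 0 = SDE.hcC i τ) && g' (jBP ![SDE.isoC i τ, f 1])))
        rw [d, h _ (hGF f), Bool.false_and, Bool.false_and]
      · show (g (jCO f) ^^ false) = (g' (jCO f) ^^ false); rw [h _ hco]

end Reads

end Summit.CriticalPhenomena.CardyFormulaZ2.Theorems.IKLinearTransport.PinnedDiagramExchange
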